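import Summits.QuantumFields.YangMills.Theorems.FradkinShenkerFlowFiniteSusceptibilityWeakCouplingEvenReduction
import Summits.QuantumFields.YangMills.Theorems.FradkinShenkerFlowFiniteSusceptibilityWeakCouplingMirrorMonotone
import HarnessLib

/-!
# Reflection parity of species; the purity half of the crux is its reflection-even sector (item stmt-QuantumFields-9442)

Support file for item stmt-QuantumFields-9442 (route `FradkinShenkerFlow` of `YangMills`), crux
`Summit.QuantumFields.YangMills.Theses.FradkinShenkerFlow.FiniteSusceptibilityWeakCoupling`, line `purity-rate-split`
(lead c20 reshape). The line cuts the crux into a purity half STUB 0 (no species has long-range order against its own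
time-mirror image at weak coupling, uniformly in the odd tori) and a rate half STUB 1, and the cut is an equivalence
(`…MirrorMonotone.finiteSusceptibilityWeakCoupling_iff_subs`). The landed `…OddSector.lean` (lattice Vafa–Witten: a
reflection-odd species never orders against its mirror image, every compact `G`, every `β ≥ 0`) and `…EvenReduction.lean`
(STUB 0 for `A` from the time-axis self-decorrelation of its even part `A + A∘Θ`) say that STUB 0 lives in the reflection-EVEN
sector. This file records that as statements about the crux, which needs the even / odd parts AS SPECIES:

* `SpeciesParity.addSpecies`, `subSpecies`, `symSpecies A = A + A∘Θ`, `antiSpecies A = A − A∘Θ` (local gauge-invariant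
  observables: union of supports, cylinder, gauge invariant, bounded, measurable) — the only definitions here, G-blind
  bookkeeping on `LocalGaugeObservable 4 G`;
* `SpeciesParity.mirrorDecorrelation_iff_even` — at fixed `(G, r, β ≥ 0)`: every species decorrelates from its mirror image
  ⟺ every reflection-EVEN species decorrelates from itself along the time axis;
* `noMirrorLongRangeOrder_iff_noEvenLongRangeOrder` — the weak-coupling statements (old STUB 0 ⟺ reshaped STUB 0′);
* `finiteSusceptibilityWeakCoupling_iff_even_subs` — **`crux ⟺ NoEvenLongRangeOrder ∧ DecorrelationForcesSummability`**:
  the purity half of finite susceptibility at weak coupling is exactly "no long-range order in the reflection-even sector".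

Nothing here is a named fact; every compact `G`. [folklore]
-/

noncomputable section

open MeasureTheory ProbabilityTheory Finset
open Literature.MathematicalPhysics.QuantumFieldTheory hiding Site ZdEdge
open Literature.MathematicalPhysics.QuantumLattice
open Literature.Probability.LatticeModels hiding configShift configShift_apply

namespace Summit.QuantumFields.YangMills.Theorems.FiniteSusceptibilityWeakCoupling

namespace SpeciesParity

open MirrorDominationAxis0 MirrorLogConvex

variable {G : Type} [Group G] [TopologicalSpace G] [IsTopologicalGroup G] [MeasurableSpace G] [BorelSpace G]

/-! ## §1 Sums, differences, even and odd parts of species -/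

/-- **The sum of two species** `A + B`: support the union, cylinder, gauge invariant, bounded, measurable. [folklore] -/
def addSpecies (A B : YMSpecies G) : YMSpecies G where
  F := fun V => A.F V + B.F V
  supp := A.supp ∪ B.supp
  isCylinder := by
    intro U V h
    have hA : A.F U = A.F V := A.isCylinder (fun e he => h e (by
      rw [Finset.coe_union]; exact Or.inl he))
    have hB : B.F U = B.F V := B.isCylinder (fun e he => h e (by
      rw [Finset.coe_union]; exact Or.inr he))
    show A.F U + B.F U = A.F V + B.F V
    rw [hA, hB]
  gaugeInvariant := fun g U => by
    show A.F (gaugeTransformZd g U) + B.F (gaugeTransformZd g U) = A.F U + B.F U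
    rw [A.gaugeInvariant, B.gaugeInvariant]
  bounded := by
    obtain ⟨a, ha⟩ := A.bounded
    obtain ⟨b, hb⟩ := B.bounded
    exact ⟨a + b, fun U => (abs_add_le _ _).trans (add_le_add (ha U) (hb U))⟩
  measurable := A.measurable.add B.measurable

/-- **The difference of two species** `A − B`. [folklore] -/
def subSpecies (A B : YMSpecies G) : YMSpecies G where
  F := fun V => A.F V - B.F V
  supp := A.supp ∪ B.supp
  isCylinder := by
    intro U V h
    have hA : A.F U = A.F V := A.isCylinder (fun e he => h e (by
      rw [Finset.coe_union]; exact Or.inl he))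
    have hB : B.F U = B.F V := B.isCylinder (fun e he => h e (by
      rw [Finset.coe_union]; exact Or.inr he))
    show A.F U - B.F U = A.F V - B.F V
    rw [hA, hB]
  gaugeInvariant := fun g U => by
    show A.F (gaugeTransformZd g U) - B.F (gaugeTransformZd g U) = A.F U - B.F U
    rw [A.gaugeInvariant, B.gaugeInvariant]
  bounded := by
    obtain ⟨a, ha⟩ := A.bounded
    obtain ⟨b, hb⟩ := B.bounded
    exact ⟨a + b, fun U => (abs_sub _ _).trans (add_le_add (ha U) (hb U))⟩
  measurable := A.measurable.sub B.measurable

/-- **The reflection-even part** `A⁺ := A + A∘Θ` of a species (`Θ = cfgReflect`, the site time reflection with temporal links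
inverted; `A∘Θ = reflSpecies A`). [folklore] -/
def symSpecies (A : YMSpecies G) : YMSpecies G := addSpecies A (reflSpecies A)

/-- **The reflection-odd part** `A⁻ := A − A∘Θ` of a species. [folklore] -/
def antiSpecies (A : YMSpecies G) : YMSpecies G := subSpecies A (reflSpecies A)

omit [TopologicalSpace G] [IsTopologicalGroup G] [BorelSpace G] in
/-- `(A + B).F = A.F + B.F` pointwise. [folklore] -/
@[simp] theorem addSpecies_F (A B : YMSpecies G) (V : LGConfig 4 G) :
    (addSpecies A B).F V = A.F V + B.F V := rfl

omit [TopologicalSpace G] [IsTopologicalGroup G] [BorelSpace G] in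
/-- `(A − B).F = A.F − B.F` pointwise. [folklore] -/
@[simp] theorem subSpecies_F (A B : YMSpecies G) (V : LGConfig 4 G) :
    (subSpecies A B).F V = A.F V - B.F V := rfl

/-- `A⁺ = A + A∘Θ` pointwise. [folklore] -/
@[simp] theorem symSpecies_F (A : YMSpecies G) (V : LGConfig 4 G) :
    (symSpecies A).F V = A.F V + A.F (cfgReflect V) := rfl

/-- `A⁻ = A − A∘Θ` pointwise. [folklore] -/
@[simp] theorem antiSpecies_F (A : YMSpecies G) (V : LGConfig 4 G) :
    (antiSpecies A).F V = A.F V - A.F (cfgReflect V) := rfl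

/-- `A⁺` is reflection-even. [folklore] -/
theorem symSpecies_even (A : YMSpecies G) (V : LGConfig 4 G) :
    (symSpecies A).F (cfgReflect V) = (symSpecies A).F V := by
  rw [symSpecies_F, symSpecies_F, cfgReflect_cfgReflect, add_comm]

/-- `A⁻` is reflection-odd. [folklore] -/
theorem antiSpecies_odd (A : YMSpecies G) (V : LGConfig 4 G) :
    (antiSpecies A).F (cfgReflect V) = -(antiSpecies A).F V := by
  rw [antiSpecies_F, antiSpecies_F, cfgReflect_cfgReflect]
  ring

/-! ## §2 At fixed `(G, r, β ≥ 0)`: mirror decorrelation ⟺ even-sector self-decorrelation -/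

variable [CompactSpace G]

/-- **Mirror decorrelation of EVERY species ⟺ time-axis self-decorrelation of every reflection-EVEN species**, at fixed
`(G, r, β ≥ 0)` and uniformly in the odd tori. `→`: for even `A` the mirror correlator is the autocorrelation. `←`: apply the
landed reduction `stub_noMirrorLRO_of_even` to `(A, A⁺, A⁻)`; `A⁺` is even, and the odd part is handled inside by the landed
lattice Vafa–Witten theorem `stub_oddSpeciesNoMirrorLRO`. [folklore] -/
theorem mirrorDecorrelation_iff_even (r : LatticeRep G) {β : ℝ} (hβ : 0 ≤ β) :
    (∀ A : YMSpecies G, ∀ ε : ℝ, 0 < ε → ∃ j₀ : ℕ, ∀ S j : ℕ, j₀ ≤ j → j ≤ S →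
        |latticeConnectedCorr r.ρ β (2 * S + 1) A.F (fun V => A.F (cfgReflect V)) j| ≤ ε) ↔
      (∀ A : YMSpecies G, (∀ V, A.F (cfgReflect V) = A.F V) → ∀ ε : ℝ, 0 < ε → ∃ j₀ : ℕ, ∀ S j : ℕ,
        j₀ ≤ j → j ≤ S → |latticeConnectedCorr r.ρ β (2 * S + 1) A.F A.F j| ≤ ε) := by
  constructor
  · intro h A hA ε hε
    have hF : (fun V => A.F (cfgReflect V)) = A.F := funext hA
    simpa only [hF] using h A ε hε
  · intro h A ε hε
    exact stub_noMirrorLRO_of_even G r β hβ A (symSpecies A) (antiSpecies A) (symSpecies_F A) (antiSpecies_F A)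
      (h (symSpecies A) (symSpecies_even A)) ε hε

/-! ## §3 The weak-coupling statements: old STUB 0 ⟺ STUB 0′; the crux ⟺ STUB 0′ ∧ STUB 1 -/

/-- **`NoMirrorLongRangeOrder ⟺ NoEvenLongRangeOrder`** (the c16–c19 purity stub ⟺ its c20 reshape): at weak coupling no
species orders against its mirror image iff no reflection-EVEN species orders along the time axis (uniformly in the odd tori;
`β₀ ↦ max β₀ 0` in the direction `←`). [folklore] -/
theorem noMirrorLongRangeOrder_iff_noEvenLongRangeOrder :
    (∀ (G : Type) [Group G] [TopologicalSpace G] [IsTopologicalGroup G] [CompactSpace G] [MeasurableSpace G]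
      [BorelSpace G], IsCompactSimpleLieGroup G → ∀ r : LatticeRep G, ∃ β₀ : ℝ, ∀ β : ℝ, β₀ ≤ β →
      ∀ A : YMSpecies G, ∀ ε : ℝ, 0 < ε → ∃ j₀ : ℕ, ∀ S j : ℕ, j₀ ≤ j → j ≤ S →
        |latticeConnectedCorr r.ρ β (2 * S + 1) A.F (fun V => A.F (cfgReflect V)) j| ≤ ε) ↔
    (∀ (G : Type) [Group G] [TopologicalSpace G] [IsTopologicalGroup G] [CompactSpace G] [MeasurableSpace G]
      [BorelSpace G], IsCompactSimpleLieGroup G → ∀ r : LatticeRep G, ∃ β₀ : ℝ, ∀ β : ℝ, β₀ ≤ β →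
      ∀ A : YMSpecies G, (∀ V, A.F (cfgReflect V) = A.F V) → ∀ ε : ℝ, 0 < ε → ∃ j₀ : ℕ, ∀ S j : ℕ,
        j₀ ≤ j → j ≤ S → |latticeConnectedCorr r.ρ β (2 * S + 1) A.F A.F j| ≤ ε) := by
  constructor
  · intro h G _ _ _ _ _ _ hG r
    obtain ⟨β₀, hβ₀⟩ := h G hG r
    refine ⟨β₀, fun β hβ A hA ε hε => ?_⟩
    have hF : (fun V => A.F (cfgReflect V)) = A.F := funext hA
    simpa only [hF] using hβ₀ β hβ A ε hε
  · intro h G _ _ _ _ _ _ hG r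
    obtain ⟨β₀, hβ₀⟩ := h G hG r
    refine ⟨max β₀ 0, fun β hβ => ?_⟩
    exact (mirrorDecorrelation_iff_even r ((le_max_right _ _).trans hβ)).2 (hβ₀ β ((le_max_left _ _).trans hβ))

/-- **`FiniteSusceptibilityWeakCoupling ⟺ NoEvenLongRangeOrder ∧ DecorrelationForcesSummability`**: the crux of item
stmt-QuantumFields-9442 is equivalent to its reshaped purity half (no long-range order in the reflection-EVEN sector at weak
coupling) together with its rate half — the landed `finiteSusceptibilityWeakCoupling_iff_subs` (`Sub₀` = all-pairs
decorrelation), `Split.decorrelation_of_mirrorDecorrelation` (mirror ⇒ all pairs, RP) and §2–§3 of this file (even ⇒ mirror).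
[folklore] -/
theorem finiteSusceptibilityWeakCoupling_iff_even_subs :
    Summit.QuantumFields.YangMills.Theses.FradkinShenkerFlow.FiniteSusceptibilityWeakCoupling ↔
    ((∀ (G : Type) [Group G] [TopologicalSpace G] [IsTopologicalGroup G] [CompactSpace G] [MeasurableSpace G]
      [BorelSpace G], IsCompactSimpleLieGroup G → ∀ r : LatticeRep G, ∃ β₀ : ℝ, ∀ β : ℝ, β₀ ≤ β →
      ∀ A : YMSpecies G, (∀ V, A.F (cfgReflect V) = A.F V) → ∀ ε : ℝ, 0 < ε → ∃ j₀ : ℕ, ∀ S j : ℕ,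
        j₀ ≤ j → j ≤ S → |latticeConnectedCorr r.ρ β (2 * S + 1) A.F A.F j| ≤ ε) ∧
    (∀ (G : Type) [Group G] [TopologicalSpace G] [IsTopologicalGroup G] [CompactSpace G] [MeasurableSpace G]
      [BorelSpace G], IsCompactSimpleLieGroup G → ∀ r : LatticeRep G, ∃ β₀ : ℝ, ∀ β : ℝ, β₀ ≤ β →
      (∀ A B : YMSpecies G, ∀ ε : ℝ, 0 < ε → ∃ n₀ : ℕ, ∀ S n : ℕ, n₀ ≤ n → n ≤ S →
        |latticeConnectedCorr r.ρ β (2 * S + 1) A.F B.F n| ≤ ε) →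
      ∀ A B : YMSpecies G, ∃ χ : ℝ, ∀ S : ℕ,
        ∑ x ∈ box 4 S, |cov[fun U => A.F (torusLift (2 * S + 1) U),
          fun U => B.F (configShift (-x) (torusLift (2 * S + 1) U));
          wilsonMeasure (d := 4) (L := 2 * S + 1) r.ρ β]| ≤ χ)) := by
  rw [finiteSusceptibilityWeakCoupling_iff_subs]
  constructor
  · rintro ⟨h₀, h₁⟩
    refine ⟨fun G _ _ _ _ _ _ hG r => ?_, h₁⟩
    obtain ⟨β₀, hβ₀⟩ := h₀ G hG r
    refine ⟨β₀, fun β hβ A hA ε hε => ?_⟩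
    have hF : (fun V => A.F (cfgReflect V)) = A.F := funext hA
    obtain ⟨n₀, hn₀⟩ := hβ₀ β hβ A (reflSpecies A) ε hε
    refine ⟨n₀, fun S j hj hjS => ?_⟩
    have := hn₀ S j hj hjS
    change |latticeConnectedCorr r.ρ β (2 * S + 1) A.F (fun V => A.F (cfgReflect V)) j| ≤ ε at this
    simpa only [hF] using this
  · rintro ⟨h₀, h₁⟩
    refine ⟨fun G _ _ _ _ _ _ hG r => ?_, h₁⟩
    obtain ⟨β₀, hβ₀⟩ := h₀ G hG r
    refine ⟨max β₀ 0, fun β hβ => ?_⟩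
    have hβ0 : (0 : ℝ) ≤ β := (le_max_right _ _).trans hβ
    have hmir := (mirrorDecorrelation_iff_even r hβ0).2 (hβ₀ β ((le_max_left _ _).trans hβ))
    refine Split.decorrelation_of_mirrorDecorrelation r hβ0 fun A ε hε => ?_
    obtain ⟨j₁, hj₁⟩ := hmir A ε hε
    obtain ⟨j₂, hj₂⟩ := hmir (reflSpecies A) ε hε
    refine ⟨max j₁ j₂, fun S j hj hjS => ⟨hj₁ S j ((le_max_left _ _).trans hj) hjS, ?_⟩⟩
    rw [← mirrorCorr_reflSpecies]
    exact hj₂ S j ((le_max_right _ _).trans hj) hjS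

end SpeciesParity

/-- **Registered sub-goal `stub_cruxIffEvenSubs`** of item stmt-QuantumFields-9442 (signature verbatim, fully qualified): the crux
`FiniteSusceptibilityWeakCoupling` is EQUIVALENT to "no long-range order in the reflection-even sector at weak coupling" together
with "decorrelation forces summability at weak coupling" — the tree-level certificate of the lead-c20 reshape of line
`purity-rate-split` (`SpeciesParity.finiteSusceptibilityWeakCoupling_iff_even_subs`). [folklore] -/
theorem stub_cruxIffEvenSubs : Summit.QuantumFields.YangMills.Theses.FradkinShenkerFlow.FiniteSusceptibilityWeakCoupling ↔ ((∀ (G : Type) [Group G] [TopologicalSpace G] [IsTopologicalGroup G] [CompactSpace G] [MeasurableSpace G] [BorelSpace G], Literature.MathematicalPhysics.QuantumFieldTheory.IsCompactSimpleLieGroup G → ∀ r : Literature.MathematicalPhysics.QuantumFieldTheory.LatticeRep G, ∃ β₀ : ℝ, ∀ β : ℝ, β₀ ≤ β → ∀ A : Literature.MathematicalPhysics.QuantumFieldTheory.YMSpecies G, (∀ V, A.F (Literature.MathematicalPhysics.QuantumFieldTheory.cfgReflect V) = A.F V) → ∀ ε : ℝ, 0 < ε → ∃ j₀ : ℕ,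 ∀ S j : ℕ, j₀ ≤ j → j ≤ S → |Literature.MathematicalPhysics.QuantumFieldTheory.latticeConnectedCorr r.ρ β (2 * S + 1) A.F A.F j| ≤ ε) ∧ (∀ (G : Type) [Group G] [TopologicalSpace G] [IsTopologicalGroup G] [CompactSpace G] [MeasurableSpace G] [BorelSpace G], Literature.MathematicalPhysics.QuantumFieldTheory.IsCompactSimpleLieGroup G → ∀ r : Literature.MathematicalPhysics.QuantumFieldTheory.LatticeRep G, ∃ β₀ : ℝ, ∀ β : ℝ, β₀ ≤ β → (∀ A B : Literature.MathematicalPhysics.QuantumFieldTheory.YMSpecies G, ∀ ε : ℝ, 0 < ε → ∃ n₀ : ℕ, ∀ S n : ℕ, n₀ ≤ n → n ≤ S → |Literature.MathematicalPhysics.QuantumFieldTheory.latticeConnectedCorr r.ρ β (2 * S + 1) A.F B.F n| ≤ ε) → ∀ A B : Literature.MathematicalPhysics.QuantumFieldTheory.YMSpecies G, ∃ χ : ℝ, ∀ S : ℕ, ∑ x ∈ Literature.Probability.LatticeModels.box 4 S, |ProbabilityTheory.covariance (fun U => A.F (Literature.MathematicalPhysics.QuantumLattice.torusLift (2 * S +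 1) U)) (fun U => B.F (Literature.MathematicalPhysics.QuantumLattice.configShift (-x) (Literature.MathematicalPhysics.QuantumLattice.torusLift (2 * S + 1) U))) (Literature.MathematicalPhysics.QuantumFieldTheory.wilsonMeasure (d := 4) (L := 2 * S + 1) r.ρ β)| ≤ χ)) :=
  SpeciesParity.finiteSusceptibilityWeakCoupling_iff_even_subs

end Summit.QuantumFields.YangMills.Theorems.FiniteSusceptibilityWeakCoupling

end
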